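import Summits.HodgeConjecture.HodgeConjecture.Theorems.F0P2aL2aKSchurGram
import Summits.HodgeConjecture.HodgeConjecture.Theorems.H413SpectrumJunction
import Literature.Geometry.ComplexHyperbolic.UnitBallIsotropyBlock
import Literature.Geometry.ComplexHyperbolic.UnitBallIsotropy
import HarnessLib

/-!
# FLOOR-0 P2a (B4-archimedean desk), line 2 `F0_P2aCohIsotypicLine`, stub S2⁺ — sub-lemma **L2a (`K_∞`-SCHUR)**:
# trace-orthogonality of two holomorphic cotangent forms upgrades to orthogonality of ALL coordinate classes

Cell hodgecm-mathlib (D-0151), FLOOR 0, crux item H413 = stmt-HodgeConjecture-24833; sub-line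
`Cruxes/H413/Lines/F0_P2aCohIsotypicLine.lean` (sha16 fe64be0a9875628f), stub `stub_archOrth_hol : ArchOrthHolType` (S2⁺); the lead's cut
(F0P2a-p01, `F0/P2a/F0P2a-p01/CUT-S2plus-signatures.v2.lean`, signature **`sig_L2A'`**, owner F0P2a-p04 per desk ruling v3 (3b)).  PROOF
lane, theorems only.  The head `l2a_holds` has the type of `sig_L2A'` BINDER FOR BINDER (the edition-3 registration mints
`def L2aKSchurType : Prop` from the same text and folds `stub_L2a := F0P2aL2aKSchur.l2a_holds`).

## Content
* `apply_mul_eq_jac_transpose_mulVec`, `apply_mul_eq_sum` — the `K_∞`-TYPE LAW of a holomorphic cotangent form along any archimedean section `ιinf`: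
  `Φ (x · ιinf k) = (Jac k x₀)ᵀ *ᵥ Φ x` for `k ∈ Stab_{U(2,1)}(x₀)` (★ `weightForms` with `τ = weightOf x₀` of the cotangent cocycle,
  `τ k⁻¹ = cotangentCocycle k x₀`).
* `rightRegular_toLp_eq_sum` — on `L²` classes: `R(ιinf k) [Φ]ⱼ = ∑ᵢ (Jac k x₀)ᵀ j i • [Φ]ᵢ` (★ `SpectrumJunction.toLp_toQuotFun_mul_right`).
* `conjTranspose_mul_jac_transpose` — `(Jac k x₀)ᵀ` is UNITARY for `k` in the stabiliser (`Stab(x₀) = U(2) × U(1)`,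
  ★ `BallModel.stabilizerEquivK21`, `Jac (diag(A,d)) x₀ = d̄ • A`, ★ `Jac_blockU_x₀`).
* `jac_transpose_irreducible` — the family `{(Jac k x₀)ᵀ}` is irreducible on `ℂ²` (★ `BallModel.irred`: no stable line).
* `inner_toLp_eq_zero_of_sum_eq_zero` — **L2a for ANY unitary datum `(F, E, c, N, J)`, any archimedean section `ιinf` and compact factor
  `Kc`**: for `Φ, Φ₃ ∈ holCotForms … ιinf Kc` with `L²` coordinate classes, `∑ⱼ ⟪[Φ]ⱼ, [Φ₃]ⱼ⟫ = 0 ⇒ ⟪[Φ]ⱼ, [Φ₃]ⱼ'⟫ = 0` for all `j j'`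
  — the datum-free Gram lemma ★ `F0P2aL2aKSchurGram.inner_eq_zero_of_sum_inner_eq_zero` at `K := Stab(x₀)`, `R k := R(ιinf k)`,
  `B k := (Jac k x₀)ᵀ`; `R(x)` preserves inner products since it is norm-preserving (★ `norm_rightRegular_apply`).
* `l2a_holds` — the CM-frame instance = `sig_L2A'` token for token.

HC_CM is proved only modulo the 7 printed citations until rung 0 closes; this file proves nothing about them.

## References
* [BorelWallach2000] A. Borel, N. Wallach, 2nd ed., AMS 2000, VI 4.7–4.8 (`K = U(2) × U(1)`, `τ` on `𝔭₋`), VII 3.2.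
* [Borel1997] A. Borel, *Automorphic forms on SL₂(ℝ)*, CUP 1997, §5.14 (forms of `K`-type `τ` as functions on the group).
* [BorelJacquet1979] A. Borel, H. Jacquet, Corvallis §4.6 (the regular representation on `L²(G(F)\G(𝔸))`).
* [Jacobowitz1990] H. Jacobowitz, *An Introduction to CR Structures*, Ch. 2 §1 Lemma 6(2) (isotropy of the ball).
* Tree: ★ `Theorems/F0P2aL2aKSchurGram` (p04), ★ `Theorems/H413SpectrumJunction` (`toLp_toQuotFun_mul_right`, `leftInvariant_of_mem_holCotForms`),
  ★ `Literature/Geometry/ComplexHyperbolic/UnitBallIsotropy(.Block)`, ★ `Literature/NumberTheory/Automorphic/UnitaryGroupCohomologicalForms`.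
-/

set_option autoImplicit false
set_option linter.dupNamespace false

noncomputable section

open MeasureTheory NumberField MulAction
open scoped InnerProductSpace ENNReal ComplexOrder Matrix

namespace Summit.HodgeConjecture.HodgeConjecture.Cruxes.H413.F0P2aL2aKSchur

open Literature.NumberTheory.Automorphic Literature.NumberTheory.Automorphic.UnitaryGroup
open Literature.NumberTheory.Automorphic.UnitaryGroup.CotangentForms (toQuotFun cmArchSection cmCompactFactor holCotForms
  mem_holCotForms_iff)
open Literature.AlgebraicGeometry.ShimuraVarieties (BallForms.cotangentCocycle BallForms.cotangentCocycle_apply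
  BallForms.isPullbackCocycle_cotangentCocycle)
open Literature.Geometry.ComplexHyperbolic.BallModel (U21 x₀ Jac)
open Summit.HodgeConjecture.HodgeConjecture.Cruxes.H413.SpectrumJunction (toLp_toQuotFun_mul_right leftInvariant_of_mem_holCotForms)
open Summit.HodgeConjecture.HodgeConjecture.Cruxes.H413.F0P2aL2aKSchurGram (inner_eq_zero_of_sum_inner_eq_zero
  irreducible_fin_two_of_wedge)

/-! ## §1 The `K_∞`-type law of holomorphic cotangent forms and its shadow on `L²` classes -/

section KType

variable {F E : Type} [Field F] [NumberField F] [Field E] [NumberField E] [Algebra F E]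
  {c : E ≃ₐ[F] E} {N : ℕ} {J : Matrix (Fin N) (Fin N) E}
  {ιinf : U21 →* (adelicGroupData F E c N J).Adelic} {Kc : Subgroup (adelicGroupData F E c N J).Adelic}

/-- **The `K_∞`-type law.**  For `Φ ∈ holCotForms … ιinf Kc` and `k ∈ Stab_{U(2,1)}(x₀)`: `Φ (x · ιinf k) = (Jac k x₀)ᵀ *ᵥ Φ x`
(★ `weightForms`: `Φ (x · κ k) = τ k⁻¹ (Φ x)` with `κ = ιinf ∘ incl`, `τ = weightOf x₀` of the cotangent cocycle, and
★ `IsPullbackCocycle.weightOf_inv_apply`, ★ `BallForms.cotangentCocycle_apply`). [cite: Borel1997, §5.14] [cite: BorelWallach2000, VI 4.8] -/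
theorem apply_mul_eq_jac_transpose_mulVec {Φ : (adelicGroupData F E c N J).Adelic → (Fin 2 → ℂ)}
    (hΦ : Φ ∈ holCotForms F E c N J ιinf Kc) (k : stabilizer U21 x₀) (x : (adelicGroupData F E c N J).Adelic) :
    Φ (x * ιinf (k : U21)) = (Jac (k : U21) x₀)ᵀ *ᵥ Φ x := by
  have h := (mem_holCotForms_iff.mp hΦ).1.2 k x
  rw [MonoidHom.comp_apply, Subgroup.coe_subtype, BallForms.isPullbackCocycle_cotangentCocycle.weightOf_inv_apply] at h
  rw [h, BallForms.cotangentCocycle_apply]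

/-- Coordinate form of the `K_∞`-type law: `Φ (x · ιinf k) j = ∑ᵢ (Jac k x₀)ᵀ j i * Φ x i`. [cite: Borel1997, §5.14] -/
theorem apply_mul_eq_sum {Φ : (adelicGroupData F E c N J).Adelic → (Fin 2 → ℂ)}
    (hΦ : Φ ∈ holCotForms F E c N J ιinf Kc) (k : stabilizer U21 x₀) (x : (adelicGroupData F E c N J).Adelic) (j : Fin 2) :
    Φ (x * ιinf (k : U21)) j = ∑ i, (Jac (k : U21) x₀)ᵀ j i * Φ x i := by
  rw [apply_mul_eq_jac_transpose_mulVec hΦ k x]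
  rfl

variable {μ : Measure (adelicGroupData F E c N J).automorphicQuotient}
  [SMulInvariantMeasure (adelicGroupData F E c N J).Adelic (adelicGroupData F E c N J).automorphicQuotient μ]

/-- **The `K_∞`-type law on `L²` classes.**  For `Φ ∈ holCotForms … ιinf Kc` with square-integrable coordinate classes `[Φ]ᵢ` and
`k ∈ Stab(x₀)`: `R(ιinf k) [Φ]ⱼ = ∑ᵢ (Jac k x₀)ᵀ j i • [Φ]ᵢ` (transport ★ `toLp_toQuotFun_mul_right` + the coordinate law).
[cite: BorelJacquet1979, §4.6] [cite: Borel1997, §5.14] -/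
theorem rightRegular_toLp_eq_sum {Φ : (adelicGroupData F E c N J).Adelic → (Fin 2 → ℂ)}
    (hΦ : Φ ∈ holCotForms F E c N J ιinf Kc)
    (hm : ∀ j : Fin 2, MemLp (toQuotFun (adelicGroupData F E c N J) fun x => Φ x j) 2 μ)
    (k : stabilizer U21 x₀) (j : Fin 2) :
    (adelicGroupData F E c N J).rightRegular μ (ιinf (k : U21)) ((hm j).toLp (toQuotFun (adelicGroupData F E c N J) fun x => Φ x j)) =
      ∑ i, (Jac (k : U21) x₀)ᵀ j i • (hm i).toLp (toQuotFun (adelicGroupData F E c N J) fun x => Φ x i) := by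
  have hleft : ∀ γ ∈ (adelicGroupData F E c N J).quotientSubgroup, ∀ x, (fun y => Φ y j) (γ * x) = (fun y => Φ y j) x :=
    fun γ hγ x => by simp only [leftInvariant_of_mem_holCotForms hΦ γ hγ x]
  -- the translated coordinate function is an explicit combination of the coordinates
  have hfun : (toQuotFun (adelicGroupData F E c N J) fun x => (fun y => Φ y j) (x * ιinf (k : U21))) =
      (Jac (k : U21) x₀)ᵀ j 0 • (toQuotFun (adelicGroupData F E c N J) fun x => Φ x 0) +
        (Jac (k : U21) x₀)ᵀ j 1 • (toQuotFun (adelicGroupData F E c N J) fun x => Φ x 1) := by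
    funext y
    simp only [toQuotFun, apply_mul_eq_sum hΦ k, Fin.sum_univ_two, Pi.add_apply, Pi.smul_apply, smul_eq_mul]
  have hmemk : MemLp (toQuotFun (adelicGroupData F E c N J) fun x => (fun y => Φ y j) (x * ιinf (k : U21))) 2 μ := by
    rw [hfun]
    exact ((hm 0).const_smul _).add ((hm 1).const_smul _)
  rw [← toLp_toQuotFun_mul_right hleft (ιinf (k : U21)) (hm j) hmemk, Fin.sum_univ_two, ← MemLp.toLp_const_smul,
    ← MemLp.toLp_const_smul, ← MemLp.toLp_add]
  exact MemLp.toLp_congr _ _ (Filter.EventuallyEq.of_eq hfun)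

end KType

/-! ## §2 The cotangent `K_∞`-type `k ↦ (Jac k x₀)ᵀ` is unitary and irreducible -/

section Isotropy

open Literature.Geometry.ComplexHyperbolic.BallModel (blockU blockK toK21 coe_blockK blockK_toK21 Jac_blockU_x₀ irred wedge)
open Literature.NumberTheory.Automorphic.U21 (matA sclD matA_mul_conjTranspose_self sclD_mul_star_self)

/-- **`(Jac k x₀)ᵀ` is unitary for `k ∈ Stab(x₀)`**: `k = diag(A, d)` with `A ∈ U(2)`, `|d| = 1` (★ `blockK_toK21`) and
`Jac (diag(A,d)) x₀ = d̄ • A` (★ `Jac_blockU_x₀`), so `((d̄ A)ᵀ)ᴴ (d̄ A)ᵀ = |d|² (A Aᴴ)ᵀ = 1`. [cite: BorelWallach2000, VI 4.8]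
[cite: Jacobowitz1990, Ch. 2 §1 Lemma 6(2)] -/
theorem conjTranspose_mul_jac_transpose (k : stabilizer U21 x₀) :
    ((Jac (k : U21) x₀)ᵀ)ᴴ * (Jac (k : U21) x₀)ᵀ = 1 := by
  have hk : (k : U21) = blockU (toK21 k) := by rw [← coe_blockK, blockK_toK21]
  rw [hk, Jac_blockU_x₀, Matrix.transpose_smul, Matrix.conjTranspose_smul, Matrix.smul_mul, Matrix.mul_smul, smul_smul]
  have hA : (matA (toK21 k))ᵀᴴ * (matA (toK21 k))ᵀ = 1 := by
    have h : (matA (toK21 k))ᵀᴴ = (matA (toK21 k))ᴴᵀ := by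
      ext i j
      simp [Matrix.conjTranspose_apply, Matrix.transpose_apply]
    rw [h, ← Matrix.transpose_mul, matA_mul_conjTranspose_self, Matrix.transpose_one]
  rw [hA, star_star, sclD_mul_star_self, one_smul]

/-- **The cotangent `K_∞`-type is irreducible**: no submodule of `ℂ²` other than `⊥`, `⊤` is stable under all `(Jac k x₀)ᵀ`,
`k ∈ Stab(x₀)` (★ `BallModel.irred`: every non-zero vector is moved off its line, + ★ `irreducible_fin_two_of_wedge`).
[cite: Jacobowitz1990, Ch. 2 §1 Lemma 6(2)] [cite: BorelWallach2000, VI 4.8] -/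
theorem jac_transpose_irreducible :
    ∀ W : Submodule ℂ (Fin 2 → ℂ), (∀ k : stabilizer U21 x₀, ∀ v ∈ W, (Jac (k : U21) x₀)ᵀ *ᵥ v ∈ W) → W = ⊥ ∨ W = ⊤ :=
  irreducible_fin_two_of_wedge (fun k : stabilizer U21 x₀ => (Jac (k : U21) x₀)ᵀ) fun v hv => by
    obtain ⟨g, hg, hw⟩ := irred x₀ v hv
    exact ⟨⟨g, mem_stabilizer_iff.mpr hg⟩, hw⟩

end Isotropy

/-! ## §3 L2a for any unitary datum, and the CM-frame instance `sig_L2A'` -/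

section L2a

variable {F E : Type} [Field F] [NumberField F] [Field E] [NumberField E] [Algebra F E]
  {c : E ≃ₐ[F] E} {N : ℕ} {J : Matrix (Fin N) (Fin N) E}
  {μ : Measure (adelicGroupData F E c N J).automorphicQuotient}
  [SMulInvariantMeasure (adelicGroupData F E c N J).Adelic (adelicGroupData F E c N J).automorphicQuotient μ]

/-- **L2a (`K_∞`-Schur) for ANY unitary datum and archimedean factor.**  `Φ, Φ₃ ∈ holCotForms … ιinf Kc` with square-integrable
coordinate classes; if `∑ⱼ ⟪[Φ]ⱼ, [Φ₃]ⱼ⟫ = 0` then `⟪[Φ]ⱼ, [Φ₃]ⱼ'⟫ = 0` for all `j, j'`: the Gram lemma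
★ `F0P2aL2aKSchurGram.inner_eq_zero_of_sum_inner_eq_zero` with `K := Stab(x₀)`, `R k := R(ιinf k)` (inner-product preserving),
`B k := (Jac k x₀)ᵀ` (unitary, irreducible), and the class law `rightRegular_toLp_eq_sum`. [cite: BorelWallach2000, VII 3.2]
[cite: Borel1997, §5.14] -/
theorem inner_toLp_eq_zero_of_sum_eq_zero (ιinf : U21 →* (adelicGroupData F E c N J).Adelic)
    (Kc : Subgroup (adelicGroupData F E c N J).Adelic)
    (Φ Φ₃ : (adelicGroupData F E c N J).Adelic → (Fin 2 → ℂ))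
    (hΦ : Φ ∈ holCotForms F E c N J ιinf Kc) (hΦ₃ : Φ₃ ∈ holCotForms F E c N J ιinf Kc)
    (hm : ∀ j : Fin 2, MemLp (toQuotFun (adelicGroupData F E c N J) fun x => Φ x j) 2 μ)
    (hm₃ : ∀ j : Fin 2, MemLp (toQuotFun (adelicGroupData F E c N J) fun x => Φ₃ x j) 2 μ)
    (htr : ∑ j : Fin 2, ⟪(hm j).toLp (toQuotFun (adelicGroupData F E c N J) fun x => Φ x j),
      (hm₃ j).toLp (toQuotFun (adelicGroupData F E c N J) fun x => Φ₃ x j)⟫_ℂ = 0) (j j' : Fin 2) :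
    ⟪(hm j).toLp (toQuotFun (adelicGroupData F E c N J) fun x => Φ x j),
      (hm₃ j').toLp (toQuotFun (adelicGroupData F E c N J) fun x => Φ₃ x j')⟫_ℂ = 0 :=
  inner_eq_zero_of_sum_inner_eq_zero (K := stabilizer U21 x₀)
    (fun k v => (adelicGroupData F E c N J).rightRegular μ (ιinf (k : U21)) v)
    (fun k v w =>
      -- `R(x)` preserves inner products: it is norm-preserving (★ `norm_rightRegular_apply`; = ★
      -- `AdelicGroupData.inner_rightRegular_rightRegular` of `AutomorphicLieDerivSkewAdjoint`, inlined to keep the import closure light)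
      (({ toLinearMap := ((adelicGroupData F E c N J).rightRegular μ (ιinf (k : U21)) :
              (adelicGroupData F E c N J).L2 μ →L[ℂ] (adelicGroupData F E c N J).L2 μ).toLinearMap
          norm_map' := (adelicGroupData F E c N J).norm_rightRegular_apply μ (ιinf (k : U21)) } :
          (adelicGroupData F E c N J).L2 μ →ₗᵢ[ℂ] (adelicGroupData F E c N J).L2 μ).inner_map_map v w))
    (fun k => (Jac (k : U21) x₀)ᵀ) conjTranspose_mul_jac_transpose jac_transpose_irreducible
    (fun j => (hm j).toLp (toQuotFun (adelicGroupData F E c N J) fun x => Φ x j))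
    (fun j => (hm₃ j).toLp (toQuotFun (adelicGroupData F E c N J) fun x => Φ₃ x j))
    (fun k j => rightRegular_toLp_eq_sum hΦ hm k j) (fun k j => rightRegular_toLp_eq_sum hΦ₃ hm₃ k j) htr j j'

end L2a

/-- **L2a in the CM frame — the lead's `sig_L2A'` TOKEN FOR TOKEN** (`F0/P2a/F0P2a-p01/CUT-S2plus-signatures.v2.lean`; the edition-3
fold is `theorem stub_L2a : L2aKSchurType := F0P2aL2aKSchur.l2a_holds`). [cite: BorelWallach2000, VII 3.2] [cite: Borel1997, §5.14] -/
theorem l2a_holds :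
  ∀ (L : Type) [Field L] [NumberField L] [IsCMField L] (ι : L →+* ℂ) (H : Matrix (Fin 3) (Fin 3) L) (T : GL (Fin 3) ℂ)
    (hT : (T : Matrix (Fin 3) (Fin 3) ℂ)ᴴ * H.map ι * (T : Matrix (Fin 3) (Fin 3) ℂ) = Literature.Geometry.ComplexHyperbolic.BallModel.J)
    (μ : Measure (adelicGroupData (↥(maximalRealSubfield L)) L (IsCMField.complexConj L) 3 H).automorphicQuotient)
    [(adelicGroupData (↥(maximalRealSubfield L)) L (IsCMField.complexConj L) 3 H).IsAutomorphicMeasure μ]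
    (Φ Φ₃ : (adelicGroupData (↥(maximalRealSubfield L)) L (IsCMField.complexConj L) 3 H).Adelic → (Fin 2 → ℂ)),
    Φ ∈ holCotForms (↥(maximalRealSubfield L)) L (IsCMField.complexConj L) 3 H (cmArchSection L ι H T hT) (cmCompactFactor L ι H T hT) →
    Φ₃ ∈ holCotForms (↥(maximalRealSubfield L)) L (IsCMField.complexConj L) 3 H (cmArchSection L ι H T hT) (cmCompactFactor L ι H T hT) →
    ∀ (hΦ : ∀ j : Fin 2, MemLp (toQuotFun (adelicGroupData (↥(maximalRealSubfield L)) L (IsCMField.complexConj L) 3 H) fun x => Φ x j) 2 μ)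
      (h₃ : ∀ j : Fin 2, MemLp (toQuotFun (adelicGroupData (↥(maximalRealSubfield L)) L (IsCMField.complexConj L) 3 H) fun x => Φ₃ x j) 2 μ),
    ∑ j : Fin 2, ⟪(hΦ j).toLp (toQuotFun _ fun x => Φ x j), (h₃ j).toLp (toQuotFun _ fun x => Φ₃ x j)⟫_ℂ = 0 →
    ∀ j j' : Fin 2, ⟪(hΦ j).toLp (toQuotFun _ fun x => Φ x j), (h₃ j').toLp (toQuotFun _ fun x => Φ₃ x j')⟫_ℂ = 0 :=
  fun L _ _ _ ι H T hT _ _ Φ Φ₃ hΦhol h₃hol hΦ h₃ htr j j' =>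
    inner_toLp_eq_zero_of_sum_eq_zero (cmArchSection L ι H T hT) (cmCompactFactor L ι H T hT) Φ Φ₃ hΦhol h₃hol hΦ h₃ htr j j'

end Summit.HodgeConjecture.HodgeConjecture.Cruxes.H413.F0P2aL2aKSchur

end
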